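import Literature.Probability.NegativeDependence.BallsAndBinsNegativeAssociation
import Literature.Probability.NegativeDependence.NegativeAssociationChernoffBounds
import HarnessLib

/-!
# The empty-bins indicators are negatively associated, with Chernoff bounds (Dubhashi–Ranjan, Thm. 46)

D. Dubhashi, D. Ranjan, *Balls and bins: a study in negative dependence*, Random Struct. Algorithms 13 (1998)
(held `paper:doi-10-1002-sici-1098-2418-199809-13-2-99-aid-rsa1-3-0-co-2-m`), §4.2 (pp. 21–22), verbatim:

> […] they define indicator variables `E_i := 1` iff the `i`th bin is empty, and seek to stochastically bound
> the sum `E_1 + ⋯ + E_n`. The variables `E_i` are not independent, preventing a direct application of the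
> CH–bounds. […] **Theorem 46** The empty–bins indicator variables `E_1, …, E_n` satisfy both (−A) as well
> as (−R). *Proof.* We note that `E_i = [B_i ≤ 0]`, for `i ∈ [n]` are non–increasing functions of disjoint
> variables. Applying Proposiiton 7(2), we conclude that `(E_1, ⋯, E_n)` also satisfy (−A). […] One can now
> apply the CH–bound to get tail estimates for `Pr[E_1 + ⋯ + E_n > s]`.

and §1 (p. 2): "the probability that ball `k` goes into bin `i` is `p_{i,k}`, subject only to the natural
restriction that for each ball `k`, `Σ_i p_{i,k} = 1`."

## Formalization (the tree's `ballsBins p` on `2^{σ × κ}`, bins `σ`, balls `κ`)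

* §1 normalization: `mass_oneBall`, **`mass_ballsBins`** (`μ(Ω) = ∏_k Σ_i p_{i,k}`, so `= 1` under the
  "natural restriction"), by the tree's induction on the type of balls (`ballsBins_option`).
* §2 the empty-bin events `emptyBin i = {B_i = 0}` (decreasing, depending on `binBlock i`), their joint
  indicator law `emptyBins p = eventImage emptyBin (ballsBins p)` on `2^σ`, and **`isNegAssoc_emptyBins`**
  (the (−A) half of Thm. 46, via the tree's `IsNegAssoc.eventImage_antitone` = Prop. 7 (2), non-increasing
  case, and `isNegAssoc_ballsBins` = Prop. 11).
* §4 marginals: `sum_emptyBin_ballsBins` (`Pr[bin i empty] = ∏_k Σ_{i'≠i} p_{i',k}`, by killing bin `i`),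
  **`ex_emptyBins_indicator_eq_prod_one_sub`** (`E[E_i] = ∏_k (1 - p_{i,k})` when `Σ_i p_{i,k} = 1`).
* §3 "One can now apply the CH–bound": **`emptyBins_chernoff_upper`** / **`emptyBins_chernoff_lower_sq`**
  for the number of empty bins `Z = Σ_i E_i` (the tree's `IsNegAssoc.chernoff_upper` /
  `chernoff_lower_sq` = [MR, Thms. 4.1/4.2] for NA variables), with `μ = E[Z] = Σ_i Pr[E_i = 1]`.

The (−R) half of Theorem 46 concerns the negative regression condition, which is not part of the tree's
framework (`-- TODO(general form)`).

## References

* [DubhashiRanjan1998] D. Dubhashi, D. Ranjan — §1 (the model), §4.2 Thm. 46; §2.1 Prop. 5, Prop. 7 (2).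
* [MotwaniRaghavan1995] R. Motwani, P. Raghavan, Randomized Algorithms — §4.1 Thms. 4.1, 4.2.
-/

noncomputable section

open Finset
open Literature.Combinatorics.Sahi2008

universe u

namespace Literature.Probability.NegativeDependence

variable {σ : Type u} [Fintype σ] [DecidableEq σ]

/-! ## §1 Normalization of the balls-and-bins weight -/

section Normalization

/-- Relabelling the ground set does not change the total mass. [cite: DubhashiRanjan1998, §1] -/
theorem mass_comap_equiv {α β : Type u} [Fintype α] [Fintype β] (e : α ≃ β) (ν : Finset β → ℝ) :
    mass (fun S : Finset α => ν (S.map e.toEmbedding)) = mass ν := by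
  rw [mass_def, mass_def]
  exact Fintype.sum_equiv e.finsetCongr _ _ fun S => by rw [Equiv.finsetCongr_apply]

omit [DecidableEq σ] in
/-- One ball: `μ(Ω) = Σ_i q_i`. [cite: DubhashiRanjan1998, §1 ("for each ball `k`, `Σ_i p_{i,k} = 1`")] -/
theorem mass_oneBall (q : σ → ℝ) : mass (oneBall q) = ∑ i, q i := by
  rw [mass_def]
  have h1 : ∑ T : Finset σ, oneBall q T = ∑ T ∈ (Finset.univ : Finset σ).powersetCard 1, ∏ i ∈ T, q i := by
    have hf : (Finset.univ : Finset σ).powersetCard 1 = Finset.univ.filter fun T : Finset σ => T.card = 1 := by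
      ext T
      rw [Finset.mem_powersetCard, Finset.mem_filter]
      exact ⟨fun h => ⟨Finset.mem_univ _, h.2⟩, fun h => ⟨Finset.subset_univ _, h.2⟩⟩
    rw [hf, Finset.sum_filter]
    exact Finset.sum_congr rfl fun T _ => by rw [oneBall_apply]; split_ifs <;> simp
  rw [h1, Finset.powersetCard_one, Finset.sum_map]
  exact Finset.sum_congr rfl fun i _ => Finset.prod_singleton _ _

/-- **Normalization: `μ(Ω) = ∏_k Σ_i p_{i,k}`** for the balls-and-bins weight (independent balls).
[cite: DubhashiRanjan1998, §1 ("the probability that ball `k` goes into bin `i` is `p_{i,k}`")] -/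
theorem mass_ballsBins {κ : Type u} [Fintype κ] [DecidableEq κ] (p : σ → κ → ℝ) :
    mass (ballsBins p) = ∏ k, ∑ i, p i k := by
  have main := @Fintype.induction_empty_option
    (fun (α : Type u) (_ : Fintype α) => ∀ [DecidableEq α] (p : σ → α → ℝ), mass (ballsBins p) = ∏ k, ∑ i, p i k)
    ?_ ?_ ?_ κ _
  · exact main p
  · -- relabelling the balls
    intro α β _ e h _ p
    letI : Fintype α := Fintype.ofEquiv β e.symm
    letI : DecidableEq α := e.decidableEq
    have heq : ballsBins p = fun S : Finset (σ × β) =>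
        ballsBins (fun i a => p i (e a)) (S.map ((Equiv.refl σ).prodCongr e).symm.toEmbedding) :=
      funext fun U => ballsBins_comp_equiv e p U
    rw [heq, mass_comap_equiv, h (fun i a => p i (e a))]
    exact Equiv.prod_comp e (fun k => ∑ i, p i k)
  · -- no balls
    intro _ p
    rw [mass_def, Fintype.prod_empty, Fintype.sum_eq_single (∅ : Finset (σ × PEmpty))
      (fun U hU => absurd (Finset.eq_empty_of_isEmpty U) hU), ballsBins_apply, ballInd, Fintype.prod_empty,
      Finset.prod_empty, one_mul]
  · -- one more ball
    intro α _ h _ p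
    letI : DecidableEq α := fun a b => decidable_of_iff (some a = some b) Option.some_inj
    have heq : ballsBins p = fun S : Finset (σ × Option α) =>
        prodWeight (ballsBins fun i k => p i (some k)) (oneBall fun i => p i none)
          (S.map (optionBallEquiv σ α).toEmbedding) :=
      funext fun U => ballsBins_option p U
    rw [heq, mass_comap_equiv, mass_prodWeight, h (fun i k => p i (some k)), mass_oneBall, Fintype.prod_option,
      mul_comm]

/-- Under the "natural restriction" `Σ_i p_{i,k} = 1` the balls-and-bins weight is a probability weight.
[cite: DubhashiRanjan1998, §1] -/
theorem mass_ballsBins_eq_one {κ : Type u} [Fintype κ] [DecidableEq κ] {p : σ → κ → ℝ}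
    (hp1 : ∀ k, ∑ i, p i k = 1) : mass (ballsBins p) = 1 := by
  rw [mass_ballsBins]
  exact Finset.prod_eq_one fun k _ => hp1 k

end Normalization

/-! ## §2 Theorem 46: the empty-bins indicators are NA -/

section EmptyBins

variable {κ : Type u} [Fintype κ] [DecidableEq κ]

/-- **The event "bin `i` is empty"**, `E_i = [B_i ≤ 0]`. [cite: DubhashiRanjan1998, §4.2 Thm. 46
("`E_i := 1` iff the `i`th bin is empty", "`E_i = [B_i ≤ 0]`")] -/
def emptyBin (i : σ) : Finset (Finset (σ × κ)) := Finset.univ.filter fun U => occupancy U i = 0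

/-- Membership in `emptyBin`. [cite: DubhashiRanjan1998, §4.2 Thm. 46] -/
theorem mem_emptyBin {i : σ} {U : Finset (σ × κ)} :
    U ∈ (emptyBin i : Finset (Finset (σ × κ))) ↔ occupancy U i = 0 := by
  rw [emptyBin, Finset.mem_filter, and_iff_right (Finset.mem_univ _)]

/-- `E_i` is a non-increasing function of the configuration. [cite: DubhashiRanjan1998, §4.2 proof of Thm. 46
("non–increasing functions")] -/
theorem isLowerSet_emptyBin (i : σ) :
    IsLowerSet ((emptyBin i : Finset (Finset (σ × κ))) : Set (Finset (σ × κ))) := fun U U' hU'U hU => by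
  rw [Finset.mem_coe, mem_emptyBin] at hU ⊢
  exact Nat.eq_zero_of_le_zero (hU ▸ occupancy_mono hU'U i)

/-- `E_i` depends only on bin `i`'s block. [cite: DubhashiRanjan1998, §4.2 proof of Thm. 46 ("of disjoint
variables")] -/
theorem determinedBy_emptyBin (i : σ) :
    DeterminedBy (setInd (emptyBin i : Finset (Finset (σ × κ)))) (binBlock i) := fun U U' h => by
  rw [setInd_apply, setInd_apply]
  exact if_congr (by rw [mem_emptyBin, mem_emptyBin, occupancy_eq_of_inter_binBlock i h]) rfl rfl

/-- **The joint law of the empty-bins indicators** `(E_i)_{i ∈ σ}` on `2^σ`: `T ↦ Pr[the set of empty bins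
is T]`. [cite: DubhashiRanjan1998, §4.2 Thm. 46] -/
def emptyBins (p : σ → κ → ℝ) : Finset σ → ℝ :=
  eventImage (fun i => (emptyBin i : Finset (Finset (σ × κ)))) (ballsBins p)

/-- Unfolding `emptyBins`. [cite: DubhashiRanjan1998, §4.2 Thm. 46] -/
theorem emptyBins_def (p : σ → κ → ℝ) :
    emptyBins p = eventImage (fun i => (emptyBin i : Finset (Finset (σ × κ)))) (ballsBins p) := rfl

/-- `emptyBins p ≥ 0`. [cite: DubhashiRanjan1998, §4.2 Thm. 46] -/
theorem emptyBins_nonneg {p : σ → κ → ℝ} (hp : ∀ i k, 0 ≤ p i k) (T : Finset σ) : 0 ≤ emptyBins p T :=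
  eventImage_nonneg (ballsBins_nonneg hp) T

/-- The law of the empty-bins indicators has the mass of the balls-and-bins weight (`= 1` when normalized).
[cite: DubhashiRanjan1998, §4.2 Thm. 46; §1] -/
theorem mass_emptyBins (p : σ → κ → ℝ) : mass (emptyBins p) = ∏ k, ∑ i, p i k := by
  rw [emptyBins_def, mass_eventImage, mass_ballsBins]

/-- **Dubhashi–Ranjan, Theorem 46 (the (−A) half): the empty-bins indicator variables are negatively
associated.** ("`E_i = [B_i ≤ 0]` are non-increasing functions of disjoint variables. Applying Proposition 7 (2)
…") [cite: DubhashiRanjan1998, §4.2 Thm. 46] -/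
theorem isNegAssoc_emptyBins (p : σ → κ → ℝ) (hp : ∀ i k, 0 ≤ p i k) : IsNegAssoc (emptyBins p) :=
  (isNegAssoc_ballsBins p hp).eventImage_antitone (fun i => isLowerSet_emptyBin i)
    (fun i => determinedBy_emptyBin i) fun _ _ hij => disjoint_binBlock hij

/-- **Theorem 46, as printed ((−A) half).** [cite: DubhashiRanjan1998, §4.2 Thm. 46] -/
theorem DubhashiRanjan_thm_46 (p : σ → κ → ℝ) (hp : ∀ i k, 0 ≤ p i k) : IsNegAssoc (emptyBins p) :=
  isNegAssoc_emptyBins p hp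

-- TODO(general form): the (−R) half of [DR, Thm. 46] (negative regression of `(E_i)`), which the tree's 0/1
-- framework does not express.

end EmptyBins

/-! ## §3 "One can now apply the CH–bound": the number of empty bins -/

section Chernoff

variable {κ : Type u} [Fintype κ] [DecidableEq κ]

/-- **Chernoff upper tail for the number `Z` of empty bins**: with `μ = E[Z] = Σ_i Pr[E_i = 1]`,
`Pr[Z ≥ (1+δ)μ] ≤ exp(μ(δ - (1+δ)ln(1+δ))) = F⁺(μ, δ)` (`δ > 0`), for independent balls with
`Σ_i p_{i,k} = 1`. [cite: DubhashiRanjan1998, §4.2 Thm. 46 ("One can now apply the CH–bound to get tail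
estimates for `Pr[E_1 + ⋯ + E_n > s]`"), §2.1 Prop. 5; MotwaniRaghavan1995, §4.1 Thm. 4.1] -/
theorem emptyBins_chernoff_upper {p : σ → κ → ℝ} (hp : ∀ i k, 0 ≤ p i k) (hp1 : ∀ k, ∑ i, p i k = 1)
    {δ : ℝ} (hδ : 0 < δ) :
    ∑ T ∈ Finset.univ.filter (fun T : Finset σ =>
        (1 + δ) * (∑ i, ex (emptyBins p) (fun T => if i ∈ T then (1 : ℝ) else 0)) ≤ (T.card : ℝ)),
      emptyBins p T ≤
      Real.exp ((∑ i, ex (emptyBins p) (fun T => if i ∈ T then (1 : ℝ) else 0)) *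
        (δ - (1 + δ) * Real.log (1 + δ))) := by
  have h1 : mass (emptyBins p) = 1 := by
    rw [mass_emptyBins]
    exact Finset.prod_eq_one fun k _ => hp1 k
  have key := (isNegAssoc_emptyBins p hp).chernoff_upper (emptyBins_nonneg hp) h1 Finset.univ hδ
  have hfilter : (Finset.univ.filter fun T : Finset σ =>
      (1 + δ) * (∑ i ∈ Finset.univ, ex (emptyBins p) (fun T => if i ∈ T then (1 : ℝ) else 0)) ≤
        ((T ∩ Finset.univ).card : ℝ)) =
      Finset.univ.filter fun T : Finset σ =>
        (1 + δ) * (∑ i, ex (emptyBins p) (fun T => if i ∈ T then (1 : ℝ) else 0)) ≤ (T.card : ℝ) :=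
    Finset.filter_congr fun T _ => by rw [Finset.inter_univ]
  rwa [hfilter] at key

/-- **Chernoff lower tail for the number of empty bins**: `Pr[Z ≤ (1-δ)μ] ≤ exp(-μδ²/2)` (`0 < δ < 1`).
[cite: DubhashiRanjan1998, §4.2 Thm. 46, §2.1 Prop. 5; MotwaniRaghavan1995, §4.1 Thm. 4.2] -/
theorem emptyBins_chernoff_lower_sq {p : σ → κ → ℝ} (hp : ∀ i k, 0 ≤ p i k) (hp1 : ∀ k, ∑ i, p i k = 1)
    {δ : ℝ} (hδ : 0 < δ) (hδ1 : δ < 1) :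
    ∑ T ∈ Finset.univ.filter (fun T : Finset σ =>
        (T.card : ℝ) ≤ (1 - δ) * ∑ i, ex (emptyBins p) (fun T => if i ∈ T then (1 : ℝ) else 0)),
      emptyBins p T ≤
      Real.exp (-((∑ i, ex (emptyBins p) (fun T => if i ∈ T then (1 : ℝ) else 0)) * δ ^ 2 / 2)) := by
  have h1 : mass (emptyBins p) = 1 := by
    rw [mass_emptyBins]
    exact Finset.prod_eq_one fun k _ => hp1 k
  have key := (isNegAssoc_emptyBins p hp).chernoff_lower_sq (emptyBins_nonneg hp) h1 Finset.univ hδ hδ1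
  have hfilter : (Finset.univ.filter fun T : Finset σ =>
      ((T ∩ Finset.univ).card : ℝ) ≤
        (1 - δ) * ∑ i ∈ Finset.univ, ex (emptyBins p) (fun T => if i ∈ T then (1 : ℝ) else 0)) =
      Finset.univ.filter fun T : Finset σ =>
        (T.card : ℝ) ≤ (1 - δ) * ∑ i, ex (emptyBins p) (fun T => if i ∈ T then (1 : ℝ) else 0) :=
    Finset.filter_congr fun T _ => by rw [Finset.inter_univ]
  rwa [hfilter] at key

end Chernoff


/-! ## §4 Marginals: `Pr[bin i is empty] = ∏_k (1 - p_{i,k})` -/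

section Marginals

variable {κ : Type u} [Fintype κ] [DecidableEq κ]

omit [Fintype σ] in
/-- Bin `i` is empty iff no ball lies in it. [cite: DubhashiRanjan1998, §4.2 Thm. 46 (`E_i = [B_i ≤ 0]`)] -/
theorem occupancy_eq_zero_iff {U : Finset (σ × κ)} {i : σ} : occupancy U i = 0 ↔ ∀ k, (i, k) ∉ U := by
  rw [occupancy, Finset.card_eq_zero, Finset.filter_eq_empty_iff]
  exact ⟨fun h k => h (Finset.mem_univ k), fun h k _ => h k⟩

/-- Killing bin `i` (`p_{i,k} ↦ 0`) does not change the weight of a configuration in which bin `i` is empty.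
[cite: DubhashiRanjan1998, §1 (independent balls, `Pr[ball k → bin i] = p_{i,k}`)] -/
theorem ballsBins_update_zero_of_mem {p : σ → κ → ℝ} {i : σ} {U : Finset (σ × κ)}
    (hU : U ∈ (emptyBin i : Finset (Finset (σ × κ)))) : ballsBins (Function.update p i 0) U = ballsBins p U := by
  rw [mem_emptyBin, occupancy_eq_zero_iff] at hU
  rw [ballsBins_apply, ballsBins_apply]
  congr 1
  refine Finset.prod_congr rfl fun x hx => ?_
  have hx1 : x.1 ≠ i := fun h => hU x.2 (by rw [← h]; exact hx)
  rw [Function.update_of_ne hx1]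

/-- Killing bin `i` kills every configuration with a ball in bin `i`. [cite: DubhashiRanjan1998, §1] -/
theorem ballsBins_update_zero_of_not_mem {p : σ → κ → ℝ} {i : σ} {U : Finset (σ × κ)}
    (hU : U ∉ (emptyBin i : Finset (Finset (σ × κ)))) : ballsBins (Function.update p i 0) U = 0 := by
  rw [mem_emptyBin, occupancy_eq_zero_iff] at hU
  push Not at hU
  obtain ⟨k, hk⟩ := hU
  rw [ballsBins_apply, Finset.prod_eq_zero hk (by rw [Function.update_self]; rfl), mul_zero]

/-- **`Pr[bin i is empty] = ∏_k Σ_{i' ≠ i} p_{i',k}`** (unnormalized): the weight of "bin `i` empty" is the total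
weight of the experiment with bin `i` removed. [cite: DubhashiRanjan1998, §1, §4.2 Thm. 46] -/
theorem sum_emptyBin_ballsBins (p : σ → κ → ℝ) (i : σ) :
    ∑ U ∈ (emptyBin i : Finset (Finset (σ × κ))), ballsBins p U = ∏ k, ∑ i' ∈ Finset.univ.erase i, p i' k := by
  have h1 : ∑ U ∈ (emptyBin i : Finset (Finset (σ × κ))), ballsBins p U = mass (ballsBins (Function.update p i 0)) := by
    rw [mass_def, ← Finset.sum_subset (Finset.subset_univ (emptyBin i : Finset (Finset (σ × κ))))
      fun U _ hU => ballsBins_update_zero_of_not_mem hU]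
    exact Finset.sum_congr rfl fun U hU => (ballsBins_update_zero_of_mem hU).symm
  rw [h1, mass_ballsBins]
  refine Finset.prod_congr rfl fun k _ => ?_
  rw [← Finset.add_sum_erase _ _ (Finset.mem_univ i), Function.update_self, Pi.zero_apply, zero_add]
  exact Finset.sum_congr rfl fun i' hi' => by rw [Function.update_of_ne (Finset.ne_of_mem_erase hi')]

/-- **`E[E_i] = Pr[bin i is empty] = ∏_k Σ_{i' ≠ i} p_{i',k}`** for the empty-bins law. [cite: DubhashiRanjan1998,
§4.2 Thm. 46 (`Z = Σ_i E_i`)] -/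
theorem ex_emptyBins_indicator (p : σ → κ → ℝ) (i : σ) :
    ex (emptyBins (κ := κ) p) (fun T => if i ∈ T then (1 : ℝ) else 0) = ∏ k, ∑ i' ∈ Finset.univ.erase i, p i' k := by
  rw [emptyBins_def, ex_eventImage, ex_def, ← sum_emptyBin_ballsBins]
  simp_rw [Finset.mem_filter, Finset.mem_univ, true_and, mul_ite, mul_one, mul_zero]
  rw [← Finset.sum_filter, Finset.filter_mem_eq_inter, Finset.univ_inter]

/-- **`Pr[bin i is empty] = ∏_k (1 - p_{i,k})`** under the natural restriction `Σ_i p_{i,k} = 1`; hence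
`E[Z] = Σ_i ∏_k (1 - p_{i,k})` in the Chernoff bounds above. [cite: DubhashiRanjan1998, §1, §4.2 Thm. 46] -/
theorem ex_emptyBins_indicator_eq_prod_one_sub {p : σ → κ → ℝ} (hp1 : ∀ k, ∑ i, p i k = 1) (i : σ) :
    ex (emptyBins (κ := κ) p) (fun T => if i ∈ T then (1 : ℝ) else 0) = ∏ k, (1 - p i k) := by
  rw [ex_emptyBins_indicator]
  exact Finset.prod_congr rfl fun k _ => by rw [Finset.sum_erase_eq_sub (Finset.mem_univ i), hp1 k]

end Marginals

end Literature.Probability.NegativeDependence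

end
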